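import Literature.NumberTheory.EllipticCurves.BSDSelmerPConverse
import HarnessLib

/-!
# The `p`-converse in corank one: Thm. 1.10 of Burungale–Skinner–Tian–Wan exactly as printed

Family `bsd`, companion to `Literature.NumberTheory.EllipticCurves.BSDSelmer` (bsd.S25) and
`Literature.NumberTheory.EllipticCurves.BSDSelmerPConverse`. The tree's named fact
`burungaleSkinnerTianWan_analyticRank_eq_one_of_selmerCorank_eq_one` transcribes A. Burungale,
C. Skinner, Y. Tian, X. Wan, *Zeta elements for elliptic curves and applications*,
arXiv:2409.01350v2, **Thm. 1.10** (p. 5) verbatim: `E/ℚ` of conductor `N`,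
`p ∤ 2N` ordinary, (sur_ℚ) `ρ̄_{E,p}` surjective, (ram) some `ℓ ‖ N` with `ρ̄` ramified at `ℓ`;
then `corank_{ℤ_p} Sel_{p^∞}(E/ℚ) = 1 ⟹ ord_{s=1} L(E, s) = 1`. `BSDSelmerPConverse` records the
printed proof architecture (§12, arXiv v2 PDF pp. 95–98: proof of Thm. 12.3, run for Thm. 12.11
with Prop. 12.10 — "Part II §4, pp. 82–84: Thm. 4.3 / 4.11 / Prop. 4.10" in the held TeX-derived
text, see the locator erratum under References) — (a) `p`-parity, (b) a Friedberg–Hoffstein auxiliary imaginary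
quadratic field, (c) Kato's finiteness theorem, (d) Selmer coranks under quadratic base change,
(e) the `p`-converse over the auxiliary field (Kato's main conjecture + Heegner main conjecture +
Gross–Zagier), (f) Artin factorisation of the analytic rank — and proves from these named facts
the *interim* bsd.S25 statement (`5 ≤ p`), leaving the verbatim Thm. 1.10 aside because the body
of the paper (Thm. 12.11, p. 98) is stated under the `p`-ADIC hypothesis (sur) of Part II (Thm. 9.26,
p. 86) ("The image of `ρ : G_ℚ → GL₂(𝒪_λ)` equals the subgroup of matrices with determinant in
`ℤ_p^×`"), which at `p = 3` is not implied by (sur_ℚ) for a general curve (Elkies 2006: curves with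
`ρ̄_{E,3}` onto `GL₂(𝔽₃)` and `ρ̄_{E,9}` not onto `GL₂(ℤ/9)`).

This file closes that gap and assembles **Thm. 1.10 exactly as printed** from the same leaves:
under the standing hypothesis `p ∤ 2N` of Thm. 1.10 the curve has good reduction at `p`, and for
`p = 3` C. Wuthrich, *On the integrality of modular symbols and Kato's Euler system for elliptic
curves*, Doc. Math. 19 (2014), 381–402, **Lemma 20** (p. 399 of the published text): "Let `p = 3`
and suppose `p²` does not divide the conductor `N`. If the residual representation
`ρ̄ : Gal(ℚ̄/ℚ) → GL₂(𝔽_p)` is surjective then the `p`-adic representation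
`ρ : Gal(ℚ̄/ℚ) → GL₂(ℤ_p)` is surjective, too" (proved from Elkies' parametrisation: the exotic
curves have additive reduction at `3`; used there, proof of Cor. 19, exactly to pass from (sur_ℚ)
to `p`-adic surjectivity at `p = 3`, Serre's lemma "[23, Lemme 15]" covering `p ≥ 5`). Hence
(sur_ℚ) ⇒ (sur) for every odd prime of good reduction: Serre for `p ≥ 5` (tree named fact
`serre_hasSurjectiveModNGaloisRep_pow`), Wuthrich for `p = 3`.

## Contents

* `analyticRank_eq_one_of_selmerCorank_eq_one_of_padicSurjective` — Thm. 12.11 for an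
  elliptic curve (`F = ℚ`), with explicit binders ((sur) spelled as in bsd.S20: `ρ̄_{E,p^n}`
  surjective for every `n`), PROVED from (a)–(f); the common core of the interim assembly and of
  Thm. 1.10.
* `burungaleSkinnerTianWan_analyticRank_eq_one_of_selmerCorank_eq_one_of_facts` — the verbatim
  named fact, PROVED from Serre's lifting (`p ≥ 5`), the good-reduction special case of Wuthrich's
  Lemma 20 (`p = 3`, hypothesis `hW3`), and (a)–(f).

## Design notes

* No new named fact is introduced (D-0026): Wuthrich's Lemma 20 enters as the explicit hypothesis
  `hW3` of the assembly, stated in the tree's language (`WeierstrassCurve.HasGoodReductionAtPrime 3`,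
  `WeierstrassCurve.HasSurjectiveModNGaloisRep (3 ^ n)`) in the special case `3 ∤ N` (good
  reduction at `3`) that Thm. 1.10 needs; the printed lemma assumes only `9 ∤ N`. Surjectivity of
  `ρ_{E,3^∞}` onto `GL₂(ℤ₃)` is equivalent to surjectivity of every `ρ̄_{E,3^n}` (a closed subgroup
  of `GL₂(ℤ₃)` is everything iff it maps onto every `GL₂(ℤ/3^n)`), the spelling of bsd.S20
  (`kato_divisibility`) and of `serre_hasSurjectiveModNGaloisRep_pow`.
* The other hypotheses are exactly those of
  `analyticRank_eq_one_of_selmerCorank_eq_one_of_facts` in `BSDSelmerPConverse` (tree named facts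
  `p_parity`, `friedbergHoffstein_exists_heegnerField_split_twist_ne_zero`,
  `kato_finite_of_L_one_ne_zero`, `selmerCorank_baseChange_quadratic`,
  `burungaleSkinnerTianWan_analyticRankEK_eq_one_of_selmerCorank_eq_one`, `hasEntireLFunction_rat`);
  the proof of the core is the proof printed on p. 96 (proof of Thm. 12.3), transcribed as there.
* What is NOT here: no leaf is discharged — (a), (c), (e), (f) are major theorems
  (Dokchitser–Dokchitser; Kato; Kato + Skinner–Urban + Wan + Howard + Castella–Grossi–Skinner +
  Burungale–Tian/Wan + Gross–Zagier; Wiles et al.), (b) is analytic (Friedberg–Hoffstein), (d) needs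
  restriction/corestriction on continuous cohomology; so
  `burungaleSkinnerTianWan_analyticRank_eq_one_of_selmerCorank_eq_one_holds` is not landed and the
  fact's trust base is pinned to these eight printed results instead.

## References

* [BurungaleSkinnerTianWan2024] A. Burungale, C. Skinner, Y. Tian, X. Wan, *Zeta elements for
  elliptic curves and applications*, arXiv:2409.01350v2 (2024), PRINTED numbering and arXiv v2 PDF
  pages: Thm. 1.10 (p. 5); (ram) in Thm. 9.21(c) (p. 84); (sur) in Thm. 9.26 (p. 86); §12 (pp. 95–98):
  Thm. 12.3 and its proof (p. 96), Prop. 12.10, Thm. 12.11 (p. 98). LOCATOR ERRATUM (2026-08-25,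
  checked against the arXiv v2 PDF): earlier revisions of this file gave these as "Part II (sur)
  (p. 74); Part II §4 (pp. 82–84): Thm. 4.3, Prop. 4.10, Thm. 4.11" and said that the paper numbers
  Parts I/II separately — that is the numbering of the held TeX-derived text (`lit read
  arxiv:2409.01350`, 88 chunks), whose "p. N" are chunk indices and whose extraction restarts the
  section counter inside each Part (Part II: held §s = printed §(s+8)); the paper itself numbers
  §1–§12 continuously. The quoted words are unchanged by the erratum.
* [Wuthrich2014] C. Wuthrich, *On the integrality of modular symbols and Kato's Euler system for
  elliptic curves*, Doc. Math. 19 (2014), 381–402: Lemma 20 and proof of Cor. 19 (p. 399 of the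
  published text, read 2026-08-15).
* [SerreAbelianLadic1968] J.-P. Serre, *Abelian `ℓ`-adic representations and elliptic curves*
  (1968), Ch. IV §3.4 (closed subgroups of `SL₂(ℤ_p)` onto `SL₂(𝔽_p)`, `p ≥ 5`); also S. Lang,
  *Elliptic Functions* (1987), Ch. 17 §4, Lemma (p. 178 of the held text).
-/

noncomputable section

open scoped Classical

open WeierstrassCurve

namespace Literature.NumberTheory.EllipticCurves

/-! ### The common core: Thm. 12.11 (Part II) for an elliptic curve, from (a)–(f) -/

/-- **Thm. 12.11 (Part II) for an elliptic curve, assembled from its printed ingredients**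
(Burungale–Skinner–Tian–Wan, arXiv:2409.01350v2, §12.2.3, Thm. 12.11, p. 98 — "Part II Thm. 4.11,
p. 84" of the held TeX-derived text:
"Let `g ∈ S₂(Γ₀(N))` be an elliptic newform […] `p ∤ 2N` […] `λ ∤ a_p(g)`, `ρ` satisfies (sur),
(ram) […]. Then `corank_{𝒪_λ} Sel_{λ^∞}(A_g) = 1 ⟹ ord_{s=1} L(s, A_g) = [F:ℚ]`", obtained
"Proceeding as in the proof of Theorem 12.3" (p. 96)), here for `F = ℚ`, `A_g = E` with globally
minimal model `W`, as a theorem with explicit binders: `p` an odd prime (`hp`) of good ordinary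
reduction (`hgood`, `hord`), (sur) in the `p`-adic form of Part II (Thm. 9.26, p. 86) — `ρ̄_{E,p^n}` surjective
for every `n` (`hsur`) —, (ram) in Tate-curve form (`hram`), and `corank_{ℤ_p} Sel_{p^∞}(E/ℚ) = 1`
(`hcorank`). Ingredients, as in `analyticRank_eq_one_of_selmerCorank_eq_one_of_facts`: (a) the
`p`-parity theorem (`hpar`, tree `p_parity`), (b) the Friedberg–Hoffstein field (`hFH`), (c) Kato's
finiteness theorem (`hKato`, tree `kato_finite_of_L_one_ne_zero`), (d) Selmer coranks under
quadratic base change (`hbc`, tree `selmerCorank_baseChange_quadratic`), (e) the `p`-converse over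
the auxiliary field (`hL`, `burungaleSkinnerTianWan_analyticRankEK_eq_one_of_selmerCorank_eq_one`)
and (f) modularity (`hE`, tree `hasEntireLFunction_rat`, through `analyticRankEK_eq_add_of`).
Proof as printed (p. 96): `corank = 1` and (a) give `w(E) = -1`; (b) gives an imaginary quadratic
`K` with the Heegner hypothesis for `N`, `p` split and `L(E^{(d_K)}, 1) ≠ 0`; by (c) the
`p^∞`-Selmer group of `E^{(d_K)}` is finite, of corank `0`, so by (d)
`corank_{ℤ_p} Sel_{p^∞}(E/K) = 1 + 0 = 1`; by (e) `ord_{s=1} L(E/K, s) = 1`; by (f) this is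
`ord L(E) + ord L(E^{(d_K)}) = ord L(E) + 0`. [cite: BurungaleSkinnerTianWan2024, Thm. 12.11 (p. 98) and proof of Thm. 12.3 (p. 96)] -/
theorem analyticRank_eq_one_of_selmerCorank_eq_one_of_padicSurjective
    (hpar : ∀ (W : WeierstrassCurve ℚ) [W.IsElliptic] (p : ℕ) [Fact p.Prime], p_parity W p)
    (hFH : friedbergHoffstein_exists_heegnerField_split_twist_ne_zero)
    (hKato : ∀ (W : WeierstrassCurve ℚ) [W.IsElliptic] (p : ℕ) [Fact p.Prime],
      kato_finite_of_L_one_ne_zero W p)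
    (hbc : selmerCorank_baseChange_quadratic)
    (hL : burungaleSkinnerTianWan_analyticRankEK_eq_one_of_selmerCorank_eq_one)
    (hE : hasEntireLFunction_rat)
    (W : WeierstrassCurve ℚ) [W.IsElliptic] [W.IsGloballyMinimal] (p : ℕ) [Fact p.Prime]
    (hp : p ≠ 2) (hgood : W.HasGoodReductionAtPrime p) (hord : ¬ (p : ℤ) ∣ W.frobeniusTrace p)
    (hsur : ∀ n : ℕ, W.HasSurjectiveModNGaloisRep (p ^ n : ℕ))
    (hram : ∃ ℓ : ℕ, ∃ _ : Fact ℓ.Prime, ℓ ≠ p ∧ W.HasMultiplicativeReductionAtPrime ℓ ∧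
      ¬ p ∣ padicValInt ℓ W.minimalDiscriminantInt)
    (hcorank : W.selmerCorank p = 1) :
    W.analyticRank = 1 := by
  -- (a) parity: the root number is `-1`
  have hw : W.rootNumber = -1 := by
    have h := hpar W p
    unfold p_parity at h
    rw [hcorank, pow_one] at h
    exact h.symm
  -- (b) the auxiliary imaginary quadratic field
  obtain ⟨K, _, _, hK, -, hHN, hHp, hL1⟩ := hFH W hw p (Fact.out : p.Prime) 0
  -- (c) Kato: the `p^∞`-Selmer group of the twist is finite, hence of corank `0`
  have hd : (NumberField.discr K : ℚ) ≠ 0 := by exact_mod_cast NumberField.discr_ne_zero K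
  haveI := W.isElliptic_quadraticTwist hd
  obtain ⟨-, -, hfin⟩ := hKato (W.quadraticTwist (NumberField.discr K : ℚ)) p hL1
  haveI := hfin
  have h0 : (W.quadraticTwist (NumberField.discr K : ℚ)).selmerCorank p = 0 :=
    (W.quadraticTwist (NumberField.discr K : ℚ)).selmerCorank_eq_zero_of_finite p
  -- (d) the corank over `K` is `1`
  have hK1 : (W.baseChange K).selmerCorank p = 1 := by
    rw [hbc W K hK.1 p, hcorank, h0]
  -- (e) the `p`-converse over `K`
  have hEK : analyticRankEK W K = 1 := hL W p hp hgood hord hsur hram K hK hHN hHp hK1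
  -- (f) factorisation of the analytic rank over `K`
  rw [analyticRankEK_eq_add_of hE W K, analyticRank_eq_zero_of_entireLFunction_one_ne_zero _ hL1,
    add_zero] at hEK
  exact hEK

/-! ### Thm. 1.10 as printed: (sur_ℚ) ⇒ (sur) by Serre (`p ≥ 5`) and Wuthrich (`p = 3`) -/

/-- **Burungale–Skinner–Tian–Wan, Thm. 1.10 exactly as printed, assembled from its printed
ingredients** (arXiv:2409.01350v2, Thm. 1.10, p. 5: "Let `E/ℚ` be an elliptic curve
of conductor `N`, and `p ∤ 2N` an ordinary prime. Suppose that […] (sur_ℚ) The mod `p` Galois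
representation `ρ̄ : G_ℚ → Aut_{𝔽_p} E[p]` is surjective. (ram) There exists a prime `ℓ ‖ N` such
that `ρ̄` is ramified at `ℓ`. Then `corank_{ℤ_p} Sel_{p^∞}(E/ℚ) = 1 ⟹ ord_{s=1} L(s, E/ℚ) = 1`",
the tree's named fact `burungaleSkinnerTianWan_analyticRank_eq_one_of_selmerCorank_eq_one`). The
body of the paper proves Thm. 12.11 (p. 98) under the `p`-adic hypothesis (sur) of Part II (Thm. 9.26,
p. 86), which is `analyticRank_eq_one_of_selmerCorank_eq_one_of_padicSurjective` above; the
introduction's (sur_ℚ) is converted into (sur) by two printed lifting results: for `p ≥ 5` Serre's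
lemma (`hSerre`, the named fact `serre_hasSurjectiveModNGaloisRep_pow`: a closed subgroup of
`SL₂(ℤ_p)` onto `SL₂(𝔽_p)` is everything), and for `p = 3` — where (sur_ℚ) alone does not suffice
(Elkies 2006) — C. Wuthrich, Doc. Math. 19 (2014), **Lemma 20** (p. 399): "Let `p = 3` and suppose
`p²` does not divide the conductor `N`. If the residual representation `ρ̄ : Gal(ℚ̄/ℚ) → GL₂(𝔽_p)`
is surjective then the `p`-adic representation `ρ : Gal(ℚ̄/ℚ) → GL₂(ℤ_p)` is surjective, too". The
hypothesis `hW3` is the special case "`E` has good reduction at `3`" (`3 ∤ N`, part of `p ∤ 2N` in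
Thm. 1.10) of Wuthrich's Lemma 20, spelled as in bsd.S20: `ρ̄_{E,3^n}` surjective for every `n`;
it is carried as an explicit hypothesis and not vendored as a named fact here. The remaining
hypotheses are those of `analyticRank_eq_one_of_selmerCorank_eq_one_of_padicSurjective`. Proof:
for the given odd prime `p`, either `p = 3` (use `hW3` with `hgood`) or `p ≥ 5`
(`Nat.Prime.five_le_of_ne_two_of_ne_three`, use `hSerre`); then apply the core. The interim
statement `analyticRank_eq_one_of_selmerCorank_eq_one` follows once more by
`analyticRank_eq_one_of_selmerCorank_eq_one_of_bstw`. [cite: BurungaleSkinnerTianWan2024, Thm. 1.10 (p. 5) and Thm. 12.11 (p. 98)] [cite: Wuthrich2014, Lemma 20 (p. 399)] [cite: SerreAbelianLadic1968, Ch. IV §3.4] -/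
theorem burungaleSkinnerTianWan_analyticRank_eq_one_of_selmerCorank_eq_one_of_facts
    (hSerre : serre_hasSurjectiveModNGaloisRep_pow)
    (hW3 : ∀ (W : WeierstrassCurve ℚ) [W.IsElliptic] [W.IsGloballyMinimal],
      W.HasGoodReductionAtPrime 3 → W.HasSurjectiveModNGaloisRep 3 →
        ∀ n : ℕ, W.HasSurjectiveModNGaloisRep (3 ^ n : ℕ))
    (hpar : ∀ (W : WeierstrassCurve ℚ) [W.IsElliptic] (p : ℕ) [Fact p.Prime], p_parity W p)
    (hFH : friedbergHoffstein_exists_heegnerField_split_twist_ne_zero)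
    (hKato : ∀ (W : WeierstrassCurve ℚ) [W.IsElliptic] (p : ℕ) [Fact p.Prime],
      kato_finite_of_L_one_ne_zero W p)
    (hbc : selmerCorank_baseChange_quadratic)
    (hL : burungaleSkinnerTianWan_analyticRankEK_eq_one_of_selmerCorank_eq_one)
    (hE : hasEntireLFunction_rat) :
    burungaleSkinnerTianWan_analyticRank_eq_one_of_selmerCorank_eq_one := by
  intro W _ _ p _ hp2 hgood hord hsurj hram hcorank
  -- (sur_ℚ) ⇒ (sur): Wuthrich's Lemma 20 at `p = 3`, Serre's lemma for `p ≥ 5`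
  have hsur : ∀ n : ℕ, W.HasSurjectiveModNGaloisRep (p ^ n : ℕ) := by
    by_cases h3 : p = 3
    · subst h3
      exact hW3 W hgood hsurj
    · exact hSerre W p ((Fact.out : p.Prime).five_le_of_ne_two_of_ne_three hp2 h3) hsurj
  exact analyticRank_eq_one_of_selmerCorank_eq_one_of_padicSurjective hpar hFH hKato hbc hL hE W p
    hp2 hgood hord hsur hram hcorank

end Literature.NumberTheory.EllipticCurves

end
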